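import Summits.QuantumFields.BalabanUV.Beta.D1BFx.PackedCoframeSiteProducts
import Summits.QuantumFields.BalabanUV.Beta.D1BFx.PackedPinnedLettersLoc
import Summits.QuantumFields.BalabanUV.Beta.D1BFx.PackedCoframePairWords

/-!
# BetaPertH road «BF-x» — «COFRAME-PACK-2» P3b: the bond sandwiches of the packed twisted mixed weight jet

STATUS: [folklore] torus bookkeeping of the road's (A1)-PACKED identity (BINDER row D1, slot (K), chain step (I)); NOT an estimate of Bałaban's,
NOT a discharge of any root-level binder.  Provenance: reconstruction; the manuscript(s) under audit are NOT citable.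

WHAT.  The outer sandwiches of P2's nine packed words: `D̂·(site word)·D̂ᵀ`, `D̂·(site word)·Ê[ρ]ᵀ`, `Ê[ρ]·(site word)·D̂ᵀ`, `Ê[ρ]·R̂·Ê[ρ′]ᵀ` with the
response-packed tip jets `Ê[ρ] = Σ_i r i • Ê_{e₁ i} = tipW ρ` (P1a) and the site words of P3a′ (`PackedCoframeSiteProducts`), each the bond-fibred
periodisation `(arr s K)^` of an explicit `ℤ⁴` bond kernel `K` (N1 `Dhat_mul_perT_arr_mul_Dhat_transpose`; P1a's three letters with the PLAIN weight
inside the array, `arr_jetRw ∕ arr_jetCw ∕ arr_jetRCw`):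
* §1 [folklore] the generic letters with the periodised weight `perW`: `tipW_perT_Dhat_transpose`, `Dhat_perT_tipW_transpose`, `tipW_perT_tipW_transpose`,
  `Dhat_perT_tipW₂_transpose` (product responses `ρₛ·ρₜ`), `perW_imageShift`, `perW_mul_perW`, `sum_smul_Djet_eq_tipW_perW`.
* §2 [folklore] the eleven torus sandwich identities `T•` (fifteen instances) of the words W4, W5, W7 (W8 = W7 with the weights exchanged), W9 of P2's
  expansion (their `ℤ⁴` kernels are named and packed into `cofPair` in `PackedCoframePairLoc`).
Unit `b2b-balaban-beta-d1-formalise-leaf-03` (gen 23); road owner `b2b-balaban-beta-d1-p2` (W-d1p2-g18-4∕-5, journal l.40583).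
-/

noncomputable section

namespace Summit.QuantumFields.BalabanUV.Beta.D1BFx.PackedCoframePairTerms

open Matrix
open scoped BigOperators
open Literature.Probability.LatticeModels (TorusSite)
open Literature.MathematicalPhysics.QuantumFieldTheory.Balaban1983to89
open Literature.MathematicalPhysics.QuantumFieldTheory.Balaban1983to89.Beta
open B12Sec2to5 (l1 l1_nonneg)
open ExpKernelCalculus (MKer BiLoc Decays comp shiftK Zl biLoc_comp_decays)
open OneStepResolventKernel (wsum)
open BalabanStepJetsSucc (biLoc_comp_right)
open Summit.QuantumFields.BalabanUV.Beta.TameKernelCalculus (decays_of_le)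
open Summit.QuantumFields.BalabanUV.Beta.D1BFx.SortedReblocking (torusBlockEquiv)
open Summit.QuantumFields.BalabanUV.Beta.D1BFx.SortedEmbedding (e₁)
open Summit.QuantumFields.BalabanUV.Beta.D1BFx.PeriodicArrays (arr toF decays_arr shiftK_arr)
open Summit.QuantumFields.BalabanUV.Beta.D1BFx.FibredPeriodisation (periodiseF)
open Summit.QuantumFields.BalabanUV.Beta.D1BFx.TorusCombKKT (I)
open Summit.QuantumFields.BalabanUV.Beta.D1BFx.PeriodisedProjector (Lhat Shat)
open Summit.QuantumFields.BalabanUV.Beta.D1BFx.TorusHodgeWeight (Dhat)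
open Summit.QuantumFields.BalabanUV.Beta.D1BFx.TorusCoframeJets (Djet Ljet Ljet₂)
open Summit.QuantumFields.BalabanUV.Beta.D1BFx.TorusWeightJetsCombFree (Lsq₁ Lsq₁₁ Chat)
open Summit.QuantumFields.BalabanUV.Beta.D1BFx.RJetProjector (Rgt)
open Summit.QuantumFields.BalabanUV.Beta.D1BFx.RJetAssembly (dSw)
open Summit.QuantumFields.BalabanUV.Beta.D1BFx.KGhostLeg (Cgh)
open Summit.QuantumFields.BalabanUV.Beta.D1BFx.TorusJetSandwichArrays (isPeriodic₂_Kfib summable_Kfib_row)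
open Summit.QuantumFields.BalabanUV.Beta.D1BFx.TorusGhostWordArrays (perT lapU)
open Summit.QuantumFields.BalabanUV.Beta.D1BFx.TorusBondArrays (dB dB_pos perT_eq_periodise₂ Dhat_mul_perT_arr_mul_Dhat_transpose Lhat_Chat_Lhat_eq_perT)
open Summit.QuantumFields.BalabanUV.Beta.D1BFx.TorusWeightWordArrays (shiftK_Rgt_mul decays_Rgt_dB)
open Summit.QuantumFields.BalabanUV.Beta.D1BFx.PackedPinnedLetters (tipW jetRw jetCw jetRCw sum_smul_Djet_eq_tipW resp_symm_e₁ arr_jetRw arr_jetCw arr_jetRCw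
  tsum_images_periodic tipW_mul_Yhat_mul_Dhat_transpose Dhat_mul_Yhat_mul_tipW_transpose tipW_mul_Yhat_mul_tipW_transpose)
open Summit.QuantumFields.BalabanUV.Beta.D1BFx.PackedCoframeSiteWords (perW gW qW d2W l2W biLoc_gW biLoc_qW biLoc_d2W_perW biLoc_l2W rate_aux
  biLoc_LC_gW biLoc_gW_CL biLoc_gW_Cgh biLoc_LC_d2W biLoc_LC_qW biLoc_LC_qW_CL biLoc_LC_qW_Cgh biLoc_LC_qW_Cgh_arr_gW biLoc_gW_Cgh_arr_gW biLoc_LC_l2W_CL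
  biLoc_LC_qW_Cgh_arr_qW_CL sum_smul_Ljet_eq sum_smul_Lsq₁_eq sum_smul_Ljet₂_eq sum_sum_smul_Lsq₁₁_eq)
open Summit.QuantumFields.BalabanUV.Beta.D1BFx.PackedCoframeSiteProducts (Lhat_Chat_J J_Chat_Lhat Lhat_Chat_J₂ J_Chat_J Lhat_Chat_Q_Chat_Lhat Lhat_Chat_Q_Chat_J
  Lhat_Chat_Q₂_Chat_Lhat Lhat_Chat_Q_Chat_Q_Chat_Lhat)

/-! ## §1 The bond letters with the periodised weight -/

section Letters

variable (s : ℕ) [NeZero s]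

omit [NeZero s] in
/-- [folklore] `perW s w` is `s`-periodic (P1a `tsum_images_periodic`). -/
theorem perW_imageShift (w : Fin 4 → (Fin 4 → ℤ) → ℝ) (β : Fin 4) (z t : Fin 4 → ℤ) : perW s w β (imageShift s z t) = perW s w β z :=
  tsum_images_periodic s w β z t

omit [NeZero s] in
/-- [folklore] **PRODUCT RESPONSES**: `perW s (w · perW s w′) = perW s w · perW s w′` (the second factor is periodic; `tsum_mul_right`, no summability). -/
theorem perW_mul_perW (w w' : Fin 4 → (Fin 4 → ℤ) → ℝ) :
    perW s (fun κ u => w κ u * perW s w' κ u) = fun κ u => perW s w κ u * perW s w' κ u := by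
  funext κ u
  show (∑' t : Fin 4 → ℤ, w κ (imageShift s u t) * perW s w' κ (imageShift s u t)) = _
  simp only [perW_imageShift]
  exact tsum_mul_right

variable (n p : ℕ) [NeZero n] [NeZero p]

/-- [folklore] **`Σ_i r i • Ê_{e₁ i} = tipW ρ` WITH `ρ b = perW (n·p) w b.2 b̃.1`** for responses `r` of the road's letter `hrₛ` (P1a). -/
theorem sum_smul_Djet_eq_tipW_perW (w : Fin 4 → (Fin 4 → ℤ) → ℝ) (r : Beta.Site 4 p × (TorusSite 4 n × Fin 4) → ℝ)
    (hr : ∀ i, r i = ∑' t : Fin 4 → ℤ, w i.2.2 (imageShift (n * p) (windowMap 4 (n * p) (torusBlockEquiv n p (i.1, i.2.1))) t)) :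
    ∑ i, r i • Djet (n * p) (e₁ n p i) = tipW (n * p) (fun b => perW (n * p) w b.2 (windowMap 4 (n * p) b.1)) := by
  rw [sum_smul_Djet_eq_tipW]
  congr 1
  funext b
  exact resp_symm_e₁ n p w r hr b

/-- [folklore] … and the PRODUCT responses: `Σ_i (r i·r′ i) • Ê_{e₁ i} = tipW (perW w · perW w′)`. -/
theorem sum_smul_Djet_eq_tipW_perW₂ (w w' : Fin 4 → (Fin 4 → ℤ) → ℝ) (r r' : Beta.Site 4 p × (TorusSite 4 n × Fin 4) → ℝ)
    (hr : ∀ i, r i = ∑' t : Fin 4 → ℤ, w i.2.2 (imageShift (n * p) (windowMap 4 (n * p) (torusBlockEquiv n p (i.1, i.2.1))) t))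
    (hr' : ∀ i, r' i = ∑' t : Fin 4 → ℤ, w' i.2.2 (imageShift (n * p) (windowMap 4 (n * p) (torusBlockEquiv n p (i.1, i.2.1))) t)) :
    ∑ i, (r i * r' i) • Djet (n * p) (e₁ n p i)
      = tipW (n * p) (fun b => perW (n * p) w b.2 (windowMap 4 (n * p) b.1) * perW (n * p) w' b.2 (windowMap 4 (n * p) b.1)) := by
  rw [sum_smul_Djet_eq_tipW]
  congr 1
  funext b
  rw [resp_symm_e₁ n p w r hr b, resp_symm_e₁ n p w' r' hr' b]
  rfl

variable {Y : MKer 4 Unit} {CY δY : ℝ} (hY : Decays Y CY δY) (hδY : 0 < δY) (hper : ∀ t : Fin 4 → ℤ, shiftK ((s : ℤ) • t) Y = Y)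
include hY hδY hper

/-- [folklore] **`Ê[ρ]·perT Y·D̂ᵀ = (arr s (jetRw w Y))^`** (`ρ b = perW s w b.2 b̃.1`; decaying, block-periodic `Y`; the PLAIN weight inside the array). -/
theorem tipW_perT_Dhat_transpose (w : Fin 4 → (Fin 4 → ℤ) → ℝ) {ρ : Site 4 s × Fin 4 → ℝ} (hρ : ∀ b, ρ b = perW s w b.2 (windowMap 4 s b.1)) :
    tipW s ρ * perT s Y * (Dhat 4 s)ᵀ = Matrix.of (periodiseF s (toF (arr s (jetRw w Y)))) := by
  rw [perT_eq_periodise₂,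
    tipW_mul_Yhat_mul_Dhat_transpose s (hperY := isPeriodic₂_Kfib s hper) (hrowY := summable_Kfib_row hY hδY) (ω := perW s w) (hρ := hρ),
    arr_jetRw s w hper]
  rfl

/-- [folklore] **`D̂·perT Y·Ê[ρ′]ᵀ = (arr s (jetCw w′ Y))^`** (`ρ′ b = perW s w′ b.2 b̃.1`). -/
theorem Dhat_perT_tipW_transpose (w' : Fin 4 → (Fin 4 → ℤ) → ℝ) {ρ' : Site 4 s × Fin 4 → ℝ} (hρ' : ∀ b, ρ' b = perW s w' b.2 (windowMap 4 s b.1)) :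
    Dhat 4 s * perT s Y * (tipW s ρ')ᵀ = Matrix.of (periodiseF s (toF (arr s (jetCw w' Y)))) := by
  rw [perT_eq_periodise₂,
    Dhat_mul_Yhat_mul_tipW_transpose s (hperY := isPeriodic₂_Kfib s hper) (hrowY := summable_Kfib_row hY hδY) (ω := perW s w') (hρ := hρ')
      (fun β z t => perW_imageShift s w' β z t),
    arr_jetCw s w' hper]
  rfl

/-- [folklore] **`Ê[ρ]·perT Y·Ê[ρ′]ᵀ = (arr s (jetRCw w (perW s w′) Y))^`**. -/
theorem tipW_perT_tipW_transpose (w w' : Fin 4 → (Fin 4 → ℤ) → ℝ) {ρ ρ' : Site 4 s × Fin 4 → ℝ} (hρ : ∀ b, ρ b = perW s w b.2 (windowMap 4 s b.1))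
    (hρ' : ∀ b, ρ' b = perW s w' b.2 (windowMap 4 s b.1)) :
    tipW s ρ * perT s Y * (tipW s ρ')ᵀ = Matrix.of (periodiseF s (toF (arr s (jetRCw w (perW s w') Y)))) := by
  rw [perT_eq_periodise₂,
    tipW_mul_Yhat_mul_tipW_transpose s (hperY := isPeriodic₂_Kfib s hper) (hrowY := summable_Kfib_row hY hδY) (ω := perW s w) (ω' := perW s w')
      (hρ := hρ) (hρ' := hρ') (fun β z t => perW_imageShift s w' β z t),
    arr_jetRCw s w hper (fun β z t => perW_imageShift s w' β z t)]
  rfl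

/-- [folklore] **`D̂·perT Y·Ê[ρₛρₜ]ᵀ = (arr s (jetCw (w · perW s w′) Y))^`** (PRODUCT responses; one weight stays plain inside the array). -/
theorem Dhat_perT_tipW₂_transpose (w w' : Fin 4 → (Fin 4 → ℤ) → ℝ) {ρ : Site 4 s × Fin 4 → ℝ}
    (hρ : ∀ b, ρ b = perW s w b.2 (windowMap 4 s b.1) * perW s w' b.2 (windowMap 4 s b.1)) :
    Dhat 4 s * perT s Y * (tipW s ρ)ᵀ = Matrix.of (periodiseF s (toF (arr s (jetCw (fun κ u => w κ u * perW s w' κ u) Y)))) := by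
  have hω : ∀ β z t, (fun κ u => perW s w κ u * perW s w' κ u) β (imageShift s z t) = (fun κ u => perW s w κ u * perW s w' κ u) β z :=
    fun β z t => by simp only [perW_imageShift]
  rw [perT_eq_periodise₂,
    Dhat_mul_Yhat_mul_tipW_transpose s (hperY := isPeriodic₂_Kfib s hper) (hrowY := summable_Kfib_row hY hδY)
      (ω := fun κ u => perW s w κ u * perW s w' κ u) (hρ := hρ) hω,
    arr_jetCw s _ hper]
  exact congrArg _ (congrArg _ (congrArg _ (by rw [← perW_mul_perW s w w']; rfl)))

end Letters

/-! ## §2 The fifteen sandwich terms of the computed words -/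

section Terms

variable (m : ℕ) {a : ℝ} (p : ℕ) [NeZero p] {ρ : Type*} [Fintype ρ] [DecidableEq ρ] {N : Matrix (Site 4 ((m + 1) * p)) ρ ℝ}
  {w w' : Fin 4 → (Fin 4 → ℤ) → ℝ} {C C' δ : ℝ} {P P' : Fin 4 → ℤ} {r r' : I 3 (m + 1) p → ℝ}
  (ha : 0 < a) (hN : ∀ lam : Site 4 ((m + 1) * p) → ℝ, Shat m ((m + 1) * p) *ᵥ lam = 0 ↔ ∃ c : ρ → ℝ, lam = N *ᵥ c)
  (hNinj : Function.Injective N.mulVec)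
  (hw : ∀ κ u, |w κ u| ≤ C * Real.exp (-δ * l1 (u - P))) (hw' : ∀ κ u, |w' κ u| ≤ C' * Real.exp (-δ * l1 (u - P'))) (hδ : 0 < δ)
  (hr : ∀ k, r k = ∑' t : Fin 4 → ℤ, w k.2.2 (imageShift ((m + 1) * p) (windowMap 4 ((m + 1) * p) (torusBlockEquiv (m + 1) p (k.1, k.2.1))) t))
  (hr' : ∀ k, r' k = ∑' t : Fin 4 → ℤ, w' k.2.2 (imageShift ((m + 1) * p) (windowMap 4 ((m + 1) * p) (torusBlockEquiv (m + 1) p (k.1, k.2.1))) t))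
include ha hN hNinj hw hw' hδ hr hr'

section W9

/-- [folklore] T9a: `D̂·(L̂ĈJ₂)·D̂ᵀ = (arr (dSw ((lapU∘Cgh)∘d2W w (perW s w′))))^`. -/
theorem T9a (hδB : δ ≤ dB (m + 1) a / 8) :
    Dhat 4 ((m + 1) * p) * (Lhat ((m + 1) * p) * Chat ((m + 1) * p) N * (∑ k : I 3 (m + 1) p, (r k * r' k) • Ljet₂ ((m + 1) * p) (e₁ (m + 1) p k)))
        * (Dhat 4 ((m + 1) * p))ᵀ
      = Matrix.of (periodiseF ((m + 1) * p) (toF (arr ((m + 1) * p) (dSw (comp (comp lapU (Cgh (m + 1) a)) (d2W w (perW ((m + 1) * p) w'))))))) := by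
  obtain ⟨K, -, hK⟩ := biLoc_LC_d2W m ha hw hw' hδ hδB
  rw [Lhat_Chat_J₂ m p ha hN hNinj hw hw' hδ hr hr', Dhat_mul_perT_arr_mul_Dhat_transpose _ (hK _) (by linarith)]

omit hw' in
/-- [folklore] T9b: `D̂·(L̂ĈJw)·Ê[w′]ᵀ = (arr (jetCw w′ (arr s ((lapU∘Cgh)∘gW w))))^` (no decay of `w′` needed). -/
theorem T9b (hδB : δ ≤ dB (m + 1) a / 8) :
    Dhat 4 ((m + 1) * p) * (Lhat ((m + 1) * p) * Chat ((m + 1) * p) N * (∑ k : I 3 (m + 1) p, r k • Ljet ((m + 1) * p) (e₁ (m + 1) p k)))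
        * (∑ k : I 3 (m + 1) p, r' k • Djet ((m + 1) * p) (e₁ (m + 1) p k))ᵀ
      = Matrix.of (periodiseF ((m + 1) * p) (toF (arr ((m + 1) * p) (jetCw w' (arr ((m + 1) * p) (comp (comp lapU (Cgh (m + 1) a)) (gW w))))))) := by
  obtain ⟨K, -, hK⟩ := biLoc_LC_gW m ha hw hδ hδB
  rw [Lhat_Chat_J m p ha hN hNinj hw hδ hr, sum_smul_Djet_eq_tipW_perW _ _ w' r' hr',
    Dhat_perT_tipW_transpose _ (decays_arr hK (by linarith) _) (by linarith) (shiftK_arr _ _) w' (fun b => rfl)]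

omit hw hw' hδ in
/-- [folklore] T9d: `D̂·(L̂ĈL̂)·Ê[ρₛρₜ]ᵀ = (arr (jetCw (w·perW s w′) Rgt))^`. -/
theorem T9d :
    Dhat 4 ((m + 1) * p) * (Lhat ((m + 1) * p) * Chat ((m + 1) * p) N * Lhat ((m + 1) * p))
        * (∑ k : I 3 (m + 1) p, (r k * r' k) • Djet ((m + 1) * p) (e₁ (m + 1) p k))ᵀ
      = Matrix.of (periodiseF ((m + 1) * p) (toF (arr ((m + 1) * p) (jetCw (fun κ u => w κ u * perW ((m + 1) * p) w' κ u) (Rgt (m + 1) a))))) := by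
  have hd := dB_pos (m + 1) a ha
  rw [Lhat_Chat_Lhat_eq_perT a m p ha hN hNinj, sum_smul_Djet_eq_tipW_perW₂ _ _ w w' r r' hr hr',
    Dhat_perT_tipW₂_transpose _ (decays_Rgt_dB m ha) (by linarith) (shiftK_Rgt_mul m p ha) w w' (fun b => rfl)]

end W9

section W5

/-- [folklore] T5a: `D̂·(JwĈJw′)·D̂ᵀ = (arr (dSw ((gW w∘Cgh)∘arr s (gW w′))))^`. -/
theorem T5a (hδB : δ ≤ dB (m + 1) a / 8) :
    Dhat 4 ((m + 1) * p) * ((∑ k : I 3 (m + 1) p, r k • Ljet ((m + 1) * p) (e₁ (m + 1) p k)) * Chat ((m + 1) * p) N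
        * (∑ k : I 3 (m + 1) p, r' k • Ljet ((m + 1) * p) (e₁ (m + 1) p k))) * (Dhat 4 ((m + 1) * p))ᵀ
      = Matrix.of (periodiseF ((m + 1) * p) (toF (arr ((m + 1) * p) (dSw (comp (comp (gW w) (Cgh (m + 1) a)) (arr ((m + 1) * p) (gW w'))))))) := by
  obtain ⟨K, -, hK⟩ := biLoc_gW_Cgh_arr_gW m ha hw hw' hδ hδB
  rw [J_Chat_J m p ha hN hNinj hw hw' hδ hδB hr hr', Dhat_mul_perT_arr_mul_Dhat_transpose _ (hK _) (by linarith)]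

omit hw' in
/-- [folklore] T5b: `D̂·(JwĈL̂)·Ê[w′]ᵀ = (arr (jetCw w′ (arr s (gW w∘(Cgh∘lapU)))))^`. -/
theorem T5b (hδB : δ ≤ dB (m + 1) a / 8) :
    Dhat 4 ((m + 1) * p) * ((∑ k : I 3 (m + 1) p, r k • Ljet ((m + 1) * p) (e₁ (m + 1) p k)) * Chat ((m + 1) * p) N * Lhat ((m + 1) * p))
        * (∑ k : I 3 (m + 1) p, r' k • Djet ((m + 1) * p) (e₁ (m + 1) p k))ᵀ
      = Matrix.of (periodiseF ((m + 1) * p) (toF (arr ((m + 1) * p) (jetCw w' (arr ((m + 1) * p) (comp (gW w) (comp (Cgh (m + 1) a) lapU))))))) := by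
  obtain ⟨K, -, hK⟩ := biLoc_gW_CL m ha hw hδ hδB
  rw [J_Chat_Lhat m p ha hN hNinj hw hδ hr, sum_smul_Djet_eq_tipW_perW _ _ w' r' hr',
    Dhat_perT_tipW_transpose _ (decays_arr hK (by linarith) _) (by linarith) (shiftK_arr _ _) w' (fun b => rfl)]

omit hw in
/-- [folklore] T5c: `Ê[w]·(L̂ĈJw′)·D̂ᵀ = (arr (jetRw w (arr s ((lapU∘Cgh)∘gW w′))))^`. -/
theorem T5c (hδB : δ ≤ dB (m + 1) a / 8) :
    (∑ k : I 3 (m + 1) p, r k • Djet ((m + 1) * p) (e₁ (m + 1) p k))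
        * (Lhat ((m + 1) * p) * Chat ((m + 1) * p) N * (∑ k : I 3 (m + 1) p, r' k • Ljet ((m + 1) * p) (e₁ (m + 1) p k))) * (Dhat 4 ((m + 1) * p))ᵀ
      = Matrix.of (periodiseF ((m + 1) * p) (toF (arr ((m + 1) * p) (jetRw w (arr ((m + 1) * p) (comp (comp lapU (Cgh (m + 1) a)) (gW w'))))))) := by
  obtain ⟨K, -, hK⟩ := biLoc_LC_gW m ha hw' hδ hδB
  rw [Lhat_Chat_J m p ha hN hNinj hw' hδ hr', sum_smul_Djet_eq_tipW_perW _ _ w r hr,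
    tipW_perT_Dhat_transpose _ (decays_arr hK (by linarith) _) (by linarith) (shiftK_arr _ _) w (fun b => rfl)]

omit hw hw' hδ in
/-- [folklore] T5d: `Ê[w]·(L̂ĈL̂)·Ê[w′]ᵀ = (arr (jetRCw w (perW s w′) Rgt))^`. -/
theorem T5d :
    (∑ k : I 3 (m + 1) p, r k • Djet ((m + 1) * p) (e₁ (m + 1) p k)) * (Lhat ((m + 1) * p) * Chat ((m + 1) * p) N * Lhat ((m + 1) * p))
        * (∑ k : I 3 (m + 1) p, r' k • Djet ((m + 1) * p) (e₁ (m + 1) p k))ᵀ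
      = Matrix.of (periodiseF ((m + 1) * p) (toF (arr ((m + 1) * p) (jetRCw w (perW ((m + 1) * p) w') (Rgt (m + 1) a))))) := by
  have hd := dB_pos (m + 1) a ha
  rw [Lhat_Chat_Lhat_eq_perT a m p ha hN hNinj, sum_smul_Djet_eq_tipW_perW _ _ w r hr, sum_smul_Djet_eq_tipW_perW _ _ w' r' hr',
    tipW_perT_tipW_transpose _ (decays_Rgt_dB m ha) (by linarith) (shiftK_Rgt_mul m p ha) w w' (fun b => rfl) (fun b => rfl)]

end W5

section W7

/-- [folklore] T7a: `D̂·(L̂ĈQwĈJw′)·D̂ᵀ = (arr (dSw ((((lapU∘Cgh)∘qW w)∘Cgh)∘arr s (gW w′))))^`. -/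
theorem T7a (hδB : δ ≤ dB (m + 1) a / 8) :
    Dhat 4 ((m + 1) * p) * (Lhat ((m + 1) * p) * Chat ((m + 1) * p) N * (∑ k : I 3 (m + 1) p, r k • Lsq₁ ((m + 1) * p) (e₁ (m + 1) p k))
        * Chat ((m + 1) * p) N * (∑ k : I 3 (m + 1) p, r' k • Ljet ((m + 1) * p) (e₁ (m + 1) p k))) * (Dhat 4 ((m + 1) * p))ᵀ
      = Matrix.of (periodiseF ((m + 1) * p) (toF (arr ((m + 1) * p)
          (dSw (comp (comp (comp (comp lapU (Cgh (m + 1) a)) (qW w)) (Cgh (m + 1) a)) (arr ((m + 1) * p) (gW w'))))))) := by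
  obtain ⟨K, -, hK⟩ := biLoc_LC_qW_Cgh_arr_gW m ha hw hw' hδ hδB
  rw [Lhat_Chat_Q_Chat_J m p ha hN hNinj hw hw' hδ hδB hr hr', Dhat_mul_perT_arr_mul_Dhat_transpose _ (hK _) (by linarith)]

omit hw' in
/-- [folklore] T7b: `D̂·(L̂ĈQwĈL̂)·Ê[w′]ᵀ = (arr (jetCw w′ (arr s (((lapU∘Cgh)∘qW w)∘(Cgh∘lapU)))))^`. -/
theorem T7b (hδB : δ ≤ dB (m + 1) a / 8) :
    Dhat 4 ((m + 1) * p) * (Lhat ((m + 1) * p) * Chat ((m + 1) * p) N * (∑ k : I 3 (m + 1) p, r k • Lsq₁ ((m + 1) * p) (e₁ (m + 1) p k))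
        * Chat ((m + 1) * p) N * Lhat ((m + 1) * p)) * (∑ k : I 3 (m + 1) p, r' k • Djet ((m + 1) * p) (e₁ (m + 1) p k))ᵀ
      = Matrix.of (periodiseF ((m + 1) * p) (toF (arr ((m + 1) * p)
          (jetCw w' (arr ((m + 1) * p) (comp (comp (comp lapU (Cgh (m + 1) a)) (qW w)) (comp (Cgh (m + 1) a) lapU))))))) := by
  obtain ⟨K, -, hK⟩ := biLoc_LC_qW_CL m ha hw hδ hδB
  rw [Lhat_Chat_Q_Chat_Lhat m p ha hN hNinj hw hδ hδB hr, sum_smul_Djet_eq_tipW_perW _ _ w' r' hr',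
    Dhat_perT_tipW_transpose _ (decays_arr hK (by linarith) _) (by linarith) (shiftK_arr _ _) w' (fun b => rfl)]

end W7

section W4

/-- [folklore] T4a: `D̂·(L̂ĈQ₂ĈL̂)·D̂ᵀ = (arr (dSw (((lapU∘Cgh)∘l2W s w w′)∘(Cgh∘lapU))))^`. -/
theorem T4a (hδB : δ ≤ dB (m + 1) a / 8) :
    Dhat 4 ((m + 1) * p) * (Lhat ((m + 1) * p) * Chat ((m + 1) * p) N
        * (∑ k : I 3 (m + 1) p, ∑ l : I 3 (m + 1) p, (r k * r' l) • Lsq₁₁ ((m + 1) * p) (e₁ (m + 1) p k) (e₁ (m + 1) p l))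
        * Chat ((m + 1) * p) N * Lhat ((m + 1) * p)) * (Dhat 4 ((m + 1) * p))ᵀ
      = Matrix.of (periodiseF ((m + 1) * p) (toF (arr ((m + 1) * p)
          (dSw (comp (comp (comp lapU (Cgh (m + 1) a)) (l2W ((m + 1) * p) w w')) (comp (Cgh (m + 1) a) lapU)))))) := by
  obtain ⟨K, -, hK⟩ := biLoc_LC_l2W_CL m ha hw hw' hδ hδB
  rw [Lhat_Chat_Q₂_Chat_Lhat m p ha hN hNinj hw hw' hδ hδB hr hr', Dhat_mul_perT_arr_mul_Dhat_transpose _ (hK _) (by linarith)]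

/-- [folklore] T4b: `D̂·(L̂ĈQwĈQw′ĈL̂)·D̂ᵀ = (arr (dSw (((((lapU∘Cgh)∘qW w)∘Cgh)∘arr s (qW w′))∘(Cgh∘lapU))))^`. -/
theorem T4b (hδB : δ ≤ dB (m + 1) a / 8) :
    Dhat 4 ((m + 1) * p) * (Lhat ((m + 1) * p) * Chat ((m + 1) * p) N * (∑ k : I 3 (m + 1) p, r k • Lsq₁ ((m + 1) * p) (e₁ (m + 1) p k))
        * Chat ((m + 1) * p) N * (∑ k : I 3 (m + 1) p, r' k • Lsq₁ ((m + 1) * p) (e₁ (m + 1) p k)) * Chat ((m + 1) * p) N * Lhat ((m + 1) * p))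
        * (Dhat 4 ((m + 1) * p))ᵀ
      = Matrix.of (periodiseF ((m + 1) * p) (toF (arr ((m + 1) * p)
          (dSw (comp (comp (comp (comp (comp lapU (Cgh (m + 1) a)) (qW w)) (Cgh (m + 1) a)) (arr ((m + 1) * p) (qW w')))
            (comp (Cgh (m + 1) a) lapU)))))) := by
  obtain ⟨K, -, hK⟩ := biLoc_LC_qW_Cgh_arr_qW_CL m ha hw hw' hδ hδB
  rw [Lhat_Chat_Q_Chat_Q_Chat_Lhat m p ha hN hNinj hw hw' hδ hδB hr hr', Dhat_mul_perT_arr_mul_Dhat_transpose _ (hK _) (by linarith)]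

end W4

end Terms

end Summit.QuantumFields.BalabanUV.Beta.D1BFx.PackedCoframePairTerms

end
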